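import Mathlib
import HarnessLib
import Literature.MathematicalPhysics.QuantumLattice.HubbardBandSectorCountingToolbox
import Summits.HubbardSuperconductivity.HubbardSuperconductivity.Theorems.KLProgrammeFermiSurfaceSharpCurvature

/-!
# Route `KLProgramme` (cruxes K3/K1, risk r2) — FST II Theorem 1.1 (two-loop volume) for the Hubbard band, part 1:
# the three-leg caustic — half-angle level function, exact trichotomy, joint continuity

Cell `gate-hubbard-kl`, seat fs-1 (g5), risk-register item r2 «Fermi-surface hypotheses on the window». Feldman–Salmhofer–
Trubowitz II (CPAM 51 (1998) 1133, arXiv cond-mat/9701073), Theorem 1.1: for a `d = 2` band with (A2)–(A4) the two-loop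
volume `𝓦(ε) = sup_q ∫_{S×S} 𝟙(|e(±p₁ ± p₂ + q)| ≤ ε) ≤ Q ε |log ε|` — typed as the named fact `FermiRG.VolumeBound`
(F-026, not proved in the tree; census FS-WINDOW.md §5: instantiable on the window, conditional instance
`klfs_fst2_volumeBound_hubbard`, p427907). This series PROVES the bound for the Hubbard band `ε = -2(cos k₁ + cos k₂)` on
compact level ranges `[a, b] ⊂ (-4, 0)` by an iterated-integral route: the INNER angular integral is p1b's Lemma E.1/E.3
family (`kltb_exists_angular_bound`: Cooper law `Cδ/|w|`, uniform law `C₁δ + C₂√δ`; `klan_exists_caustic_refined`: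
`C₁δ + C₃δ/√r` at sup-distance `≥ r` from the caustic `2S_μ + 2πℤ²`), and the logarithm is the number of dyadic scales
of the OUTER variable's distance to the Cooper point / to the caustic. This file is the geometric heart of the outer
caustic estimate («`p_μ(θ)` stays within `s` of a translate of the doubled curve `2S_μ` only on a set of measure `O(√s)`»):

* `klTwoLoopLevel μ c₁ c₂ θ = ε₂((X_μ(θ) - c₁)/2, (Y_μ(θ) - c₂)/2) - μ` (zero iff `p_μ(θ) ∈ c + 2S_μ + 4πℤ²`) and its
  first two `θ`-derivatives `klTwoLoopLevelDeriv`, `klTwoLoopLevelDeriv₂` in closed form (`kltl_hasDerivAt_level`,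
  `kltl_hasDerivAt_levelDeriv`); periodicity in `θ` (`2π`) and in `c` (`4π`);
* **the exact trichotomy** `kltl_levelDeriv₂_ne_zero`: `G = G' = 0 ⇒ G'' ≠ 0` — at a common zero the half point is a
  curve point whose normal is parallel to the normal at `p_μ(θ)`, hence `±p_μ(θ)` mod `2πℤ²` (Gauss-map injectivity
  modulo the central symmetry, `exists_eq_add_int_mul_pi_of_cross_eq_zero`), and the curve's second-order identity
  `sin X·X'' + sin Y·Y'' = -H` evaluates `G''` to `-H/2` or `3H/2`, `H = cos X·X'² + cos Y·Y'² > 0` (`bandHess_pos`): the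
  curvatures of `S_μ` and `2S_μ` differ at every tangency;
* joint continuity of `X, Y, X', Y', X'', Y''` and of `G, G', G''` in `(μ, c₁, c₂, θ)` on `(-4, 0) × ℝ³` (the
  accelerations through their solved form `W·X'' = -(XH + 2uu' sin Y)`, `klfs_W_mul_bandAX`).

Parts 2–3: `KLProgrammeFermiSurfaceTwoLoopWindow.lean` (real-variable window lemmas, Cooper side),
`KLProgrammeFermiSurfaceTwoLoopCaustic.lean` (compactness modulus, the `O(√s)` caustic estimate). Three definitions (the
level function and its two derivatives, used only inside this argument); everything else PROVED. [folklore]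
-/

noncomputable section

open Real Set MeasureTheory
open scoped ENNReal

-- the tree's namespace `Summit.<Summit>.<Problem>.Theorems` repeats the summit name by design (D-0017)
set_option linter.dupNamespace false

namespace Summit.HubbardSuperconductivity.HubbardSuperconductivity.Theorems

open Literature.MathematicalPhysics.QuantumLattice
open Literature.MathematicalPhysics.QuantumLattice.BandSectorCounting

/-! ### §2 The half-angle level function `G_c(θ) = ε₂((p_μ(θ) - c)/2) - μ` and its first two derivatives

`G_c` vanishes exactly when `p_μ(θ) - c ∈ 2S_μ + 4πℤ²`, i.e. when `p_μ(θ)` lies on the doubled Fermi curve translated by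
`c`; its sublevel sets are the outer variable's neighbourhoods of the two-loop caustic. Three definitions (the function
and its first two `θ`-derivatives, in closed form), used only inside this two-loop volume argument. -/

/-- The half-angle level function `G_c(θ) = ε₂((X_μ(θ) - c₁)/2, (Y_μ(θ) - c₂)/2) - μ` of the outer two-loop variable
(zero iff `p_μ(θ) ∈ c + 2S_μ + 4πℤ²`). [folklore] -/
def klTwoLoopLevel (μ c₁ c₂ θ : ℝ) : ℝ :=
  -2 * (Real.cos ((bandX μ θ - c₁) / 2) + Real.cos ((bandY μ θ - c₂) / 2)) - μ

/-- Its `θ`-derivative `G_c'(θ) = sin((X-c₁)/2)·X' + sin((Y-c₂)/2)·Y'`. [folklore] -/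
def klTwoLoopLevelDeriv (μ c₁ c₂ θ : ℝ) : ℝ :=
  Real.sin ((bandX μ θ - c₁) / 2) * bandVX μ θ + Real.sin ((bandY μ θ - c₂) / 2) * bandVY μ θ

/-- Its second `θ`-derivative `G_c''(θ) = cos((X-c₁)/2)·X'²/2 + sin((X-c₁)/2)·X'' + cos((Y-c₂)/2)·Y'²/2 + sin((Y-c₂)/2)·Y''`.
[folklore] -/
def klTwoLoopLevelDeriv₂ (μ c₁ c₂ θ : ℝ) : ℝ :=
  Real.cos ((bandX μ θ - c₁) / 2) * bandVX μ θ ^ 2 / 2 + Real.sin ((bandX μ θ - c₁) / 2) * bandAX μ θ +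
    (Real.cos ((bandY μ θ - c₂) / 2) * bandVY μ θ ^ 2 / 2 + Real.sin ((bandY μ θ - c₂) / 2) * bandAY μ θ)

section HalfLevel

variable {μ : ℝ} (hμ₁ : -4 < μ) (hμ₂ : μ < 0)
include hμ₁ hμ₂

/-- `∂_θ G_c = G_c'`. [folklore] -/
theorem kltl_hasDerivAt_level (c₁ c₂ θ : ℝ) :
    HasDerivAt (klTwoLoopLevel μ c₁ c₂) (klTwoLoopLevelDeriv μ c₁ c₂ θ) θ := by
  have hx := ((hasDerivAt_bandX hμ₁ hμ₂ θ).sub_const c₁).div_const 2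
  have hy := ((hasDerivAt_bandY hμ₁ hμ₂ θ).sub_const c₂).div_const 2
  have h := ((hx.cos.add hy.cos).const_mul (-2)).sub_const μ
  refine (h.congr_deriv ?_).congr_of_eventuallyEq (Filter.Eventually.of_forall fun ϑ => rfl)
  simp only [klTwoLoopLevelDeriv]; ring

/-- `∂_θ G_c' = G_c''`. [folklore] -/
theorem kltl_hasDerivAt_levelDeriv (c₁ c₂ θ : ℝ) :
    HasDerivAt (klTwoLoopLevelDeriv μ c₁ c₂) (klTwoLoopLevelDeriv₂ μ c₁ c₂ θ) θ := by
  have hx := ((hasDerivAt_bandX hμ₁ hμ₂ θ).sub_const c₁).div_const 2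
  have hy := ((hasDerivAt_bandY hμ₁ hμ₂ θ).sub_const c₂).div_const 2
  have h := (hx.sin.mul (hasDerivAt_bandVX hμ₁ hμ₂ θ)).add (hy.sin.mul (hasDerivAt_bandVY hμ₁ hμ₂ θ))
  refine (h.congr_deriv ?_).congr_of_eventuallyEq (Filter.Eventually.of_forall fun ϑ => rfl)
  simp only [klTwoLoopLevelDeriv₂]; ring

/-- `G_c` is `2π`-periodic in `θ`. [folklore] -/
theorem kltl_level_add_int_mul_two_pi (c₁ c₂ θ : ℝ) (k : ℤ) :
    klTwoLoopLevel μ c₁ c₂ (θ + k * (2 * π)) = klTwoLoopLevel μ c₁ c₂ θ := by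
  obtain ⟨hx, hy, -, -⟩ := band_add_int_mul_two_pi hμ₁ hμ₂ θ k
  simp only [klTwoLoopLevel, hx, hy]

omit hμ₁ hμ₂ in
/-- `G_c` is `4π`-periodic in each component of `c`. [folklore] -/
theorem kltl_level_sub_int_mul_four_pi (c₁ c₂ θ : ℝ) (n₀ n₁ : ℤ) :
    klTwoLoopLevel μ (c₁ - n₀ * (4 * π)) (c₂ - n₁ * (4 * π)) θ = klTwoLoopLevel μ c₁ c₂ θ := by
  have e₀ : (bandX μ θ - (c₁ - n₀ * (4 * π))) / 2 = (bandX μ θ - c₁) / 2 + n₀ * (2 * π) := by ring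
  have e₁ : (bandY μ θ - (c₂ - n₁ * (4 * π))) / 2 = (bandY μ θ - c₂) / 2 + n₁ * (2 * π) := by ring
  simp only [klTwoLoopLevel, e₀, e₁, Real.cos_add_int_mul_two_pi]

/-! ### §3 The exact trichotomy: `G_c(θ) = 0` and `G_c'(θ) = 0` force `G_c''(θ) ∈ {-H/2, 3H/2}`, `H > 0`

If `(p_μ(θ) - c)/2` lies on the level set and the level set's normal there is orthogonal to `p_μ'(θ)`, then by the
injectivity of the Gauss map modulo the central symmetry (`exists_eq_add_int_mul_pi_of_cross_eq_zero`) that point is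
`±p_μ(θ)` modulo `2πℤ²`; the second-order identity `sin X·X'' + sin Y·Y'' = -H` of the curve then evaluates `G_c''(θ)`
to `H/2 - H` or `H/2 + H`, with `H = cos X·X'² + cos Y·Y'² > 0` (`bandHess_pos`). -/

/-- A point of the level set `ε₂ = μ` (anywhere in the plane) is a curve point modulo `2πℤ²`. [folklore] -/
theorem kltl_exists_angle_of_eps2_eq {X Y : ℝ} (he : eps2 X Y = μ) :
    ∃ (φ : ℝ) (n₀ n₁ : ℤ), X = bandX μ φ + n₀ * (2 * π) ∧ Y = bandY μ φ + n₁ * (2 * π) := by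
  obtain ⟨n₀, h₀⟩ := exists_int_abs_sub_le_pi X
  obtain ⟨n₁, h₁⟩ := exists_int_abs_sub_le_pi Y
  have he' : eps2 (X - n₀ * (2 * π)) (Y - n₁ * (2 * π)) = μ := by rw [eps2_sub_int_mul]; exact he
  obtain ⟨hx, hy⟩ := band_eq_of_level hμ₁ hμ₂ h₀ h₁ he'
  exact ⟨_, n₀, n₁, by linarith, by linarith⟩

/-- **The exact trichotomy.** At a common zero of `G_c` and `G_c'`, `G_c'' ≠ 0`. [folklore] -/
theorem kltl_levelDeriv₂_ne_zero {c₁ c₂ θ : ℝ} (h0 : klTwoLoopLevel μ c₁ c₂ θ = 0)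
    (h1 : klTwoLoopLevelDeriv μ c₁ c₂ θ = 0) : klTwoLoopLevelDeriv₂ μ c₁ c₂ θ ≠ 0 := by
  unfold klTwoLoopLevel at h0
  unfold klTwoLoopLevelDeriv at h1
  unfold klTwoLoopLevelDeriv₂
  -- the half point is a curve point `p_μ(φ)` modulo `2πℤ²`
  have he : eps2 ((bandX μ θ - c₁) / 2) ((bandY μ θ - c₂) / 2) = μ := by unfold eps2; linarith
  obtain ⟨φ, n₀, n₁, hX, hY⟩ := kltl_exists_angle_of_eps2_eq hμ₁ hμ₂ he
  have hsinX : Real.sin ((bandX μ θ - c₁) / 2) = Real.sin (bandX μ φ) := by rw [hX, Real.sin_add_int_mul_two_pi]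
  have hsinY : Real.sin ((bandY μ θ - c₂) / 2) = Real.sin (bandY μ φ) := by rw [hY, Real.sin_add_int_mul_two_pi]
  have hcosX : Real.cos ((bandX μ θ - c₁) / 2) = Real.cos (bandX μ φ) := by rw [hX, Real.cos_add_int_mul_two_pi]
  have hcosY : Real.cos ((bandY μ θ - c₂) / 2) = Real.cos (bandY μ φ) := by rw [hY, Real.cos_add_int_mul_two_pi]
  rw [hsinX, hsinY] at h1
  -- the two gradients are orthogonal to the same non-zero velocity, hence parallel
  have htan := sin_mul_bandVX_add hμ₁ hμ₂ θ
  have hu2 := bandVY_mul_bandX_sub μ θ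
  have hu := bandFermiRadius_pos hμ₁ hμ₂ θ
  have hcross : Real.sin (bandX μ θ) * Real.sin (bandY μ φ) - Real.sin (bandY μ θ) * Real.sin (bandX μ φ) = 0 := by
    set C := Real.sin (bandX μ θ) * Real.sin (bandY μ φ) - Real.sin (bandY μ θ) * Real.sin (bandX μ φ) with hC
    have hCx : C * bandVX μ θ = 0 := by
      rw [hC]; linear_combination (Real.sin (bandY μ φ)) * htan - (Real.sin (bandY μ θ)) * h1
    have hCy : C * bandVY μ θ = 0 := by
      rw [hC]; linear_combination (-(Real.sin (bandX μ φ))) * htan + (Real.sin (bandX μ θ)) * h1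
    have hCu : C * bandFermiRadius μ θ ^ 2 = 0 := by
      rw [← hu2]; linear_combination (bandX μ θ) * hCy - (bandY μ θ) * hCx
    rcases mul_eq_zero.1 hCu with h | h
    · exact h
    · exact absurd h (by positivity)
  obtain ⟨j, hj⟩ := exists_eq_add_int_mul_pi_of_cross_eq_zero hμ₁ hμ₂ hcross
  obtain ⟨σ, hσ, hxj, hyj, -, -⟩ := band_add_int_mul_pi hμ₁ hμ₂ θ j
  rw [← hj] at hxj hyj
  have hH := bandHess_pos hμ₁ hμ₂ θ
  have hacc := sin_mul_acc_eq_neg_hess hμ₁ hμ₂ θ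
  rw [hcosX, hcosY, hsinX, hsinY, hxj, hyj]
  rcases hσ with rfl | rfl
  · simp only [one_mul]
    nlinarith
  · simp only [neg_mul, one_mul, Real.cos_neg, Real.sin_neg]
    nlinarith

end HalfLevel

/-! ### §4 Joint continuity in `(μ, c₁, c₂, θ)` on `(-4, 0) × ℝ³`

Parameters are bundled as `p = (μ, c₁, c₂, θ) : ℝ × ℝ × ℝ × ℝ`. The radius `u_μ(θ)` and its angular derivative are
jointly continuous (`continuousOn_bandFermiRadius`, `continuousOn_bandFermiRadius_angleDeriv`); the second derivatives
`X'', Y''` are jointly continuous through their solved form `W·X'' = -(X H + 2uu' sin Y)`, `W·Y'' = 2uu' sin X - Y H`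
(`klfs_W_mul_bandAX/AY`, `W = c u² > 0`). -/

section Joint

/-- `(μ, θ) ↦ u_μ(θ)` on the bundled parameter space. [folklore] -/
theorem kltl_continuousOn_radius :
    ContinuousOn (fun p : ℝ × ℝ × ℝ × ℝ => bandFermiRadius p.1 p.2.2.2) {p | p.1 ∈ Ioo (-4 : ℝ) 0} := by
  have hπ : Continuous fun p : ℝ × ℝ × ℝ × ℝ => ((p.1, p.2.2.2) : ℝ × ℝ) := by fun_prop
  have hm : MapsTo (fun p : ℝ × ℝ × ℝ × ℝ => ((p.1, p.2.2.2) : ℝ × ℝ)) {p | p.1 ∈ Ioo (-4 : ℝ) 0}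
      (Ioo (-4 : ℝ) 0 ×ˢ univ) := fun p hp => ⟨hp, mem_univ _⟩
  have h := continuousOn_bandFermiRadius.comp hπ.continuousOn hm
  simpa only [Function.comp_def] using h

/-- `(μ, θ) ↦ u_μ'(θ)` on the bundled parameter space. [folklore] -/
theorem kltl_continuousOn_radiusDeriv :
    ContinuousOn (fun p : ℝ × ℝ × ℝ × ℝ => bandFermiRadiusDeriv p.1 p.2.2.2) {p | p.1 ∈ Ioo (-4 : ℝ) 0} := by
  have hπ : Continuous fun p : ℝ × ℝ × ℝ × ℝ => ((p.1, p.2.2.2) : ℝ × ℝ) := by fun_prop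
  have hm : MapsTo (fun p : ℝ × ℝ × ℝ × ℝ => ((p.1, p.2.2.2) : ℝ × ℝ)) {p | p.1 ∈ Ioo (-4 : ℝ) 0}
      (Ioo (-4 : ℝ) 0 ×ˢ univ) := fun p hp => ⟨hp, mem_univ _⟩
  have h := continuousOn_bandFermiRadius_angleDeriv.comp hπ.continuousOn hm
  simpa only [Function.comp_def] using h

/-- `X` jointly continuous. [folklore] -/
theorem kltl_continuousOn_bandX :
    ContinuousOn (fun p : ℝ × ℝ × ℝ × ℝ => bandX p.1 p.2.2.2) {p | p.1 ∈ Ioo (-4 : ℝ) 0} := by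
  simp only [bandX]
  exact kltl_continuousOn_radius.mul (by fun_prop : Continuous fun p : ℝ × ℝ × ℝ × ℝ => Real.cos p.2.2.2).continuousOn

/-- `Y` jointly continuous. [folklore] -/
theorem kltl_continuousOn_bandY :
    ContinuousOn (fun p : ℝ × ℝ × ℝ × ℝ => bandY p.1 p.2.2.2) {p | p.1 ∈ Ioo (-4 : ℝ) 0} := by
  simp only [bandY]
  exact kltl_continuousOn_radius.mul (by fun_prop : Continuous fun p : ℝ × ℝ × ℝ × ℝ => Real.sin p.2.2.2).continuousOn

/-- `X'` jointly continuous. [folklore] -/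
theorem kltl_continuousOn_bandVX :
    ContinuousOn (fun p : ℝ × ℝ × ℝ × ℝ => bandVX p.1 p.2.2.2) {p | p.1 ∈ Ioo (-4 : ℝ) 0} := by
  simp only [bandVX]
  exact (kltl_continuousOn_radiusDeriv.mul
    (by fun_prop : Continuous fun p : ℝ × ℝ × ℝ × ℝ => Real.cos p.2.2.2).continuousOn).sub
    (kltl_continuousOn_radius.mul (by fun_prop : Continuous fun p : ℝ × ℝ × ℝ × ℝ => Real.sin p.2.2.2).continuousOn)

/-- `Y'` jointly continuous. [folklore] -/
theorem kltl_continuousOn_bandVY :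
    ContinuousOn (fun p : ℝ × ℝ × ℝ × ℝ => bandVY p.1 p.2.2.2) {p | p.1 ∈ Ioo (-4 : ℝ) 0} := by
  simp only [bandVY]
  exact (kltl_continuousOn_radiusDeriv.mul
    (by fun_prop : Continuous fun p : ℝ × ℝ × ℝ × ℝ => Real.sin p.2.2.2).continuousOn).add
    (kltl_continuousOn_radius.mul (by fun_prop : Continuous fun p : ℝ × ℝ × ℝ × ℝ => Real.cos p.2.2.2).continuousOn)

/-- The solved acceleration `X'' = -(X H + 2uu' sin Y)/W` on the hole-doped band. [folklore] -/
theorem kltl_bandAX_eq_div {μ : ℝ} (hμ₁ : -4 < μ) (hμ₂ : μ < 0) (θ : ℝ) :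
    bandAX μ θ = -(bandX μ θ * (Real.cos (bandX μ θ) * bandVX μ θ ^ 2 + Real.cos (bandY μ θ) * bandVY μ θ ^ 2) +
        2 * bandFermiRadius μ θ * bandFermiRadiusDeriv μ θ * Real.sin (bandY μ θ)) /
      (bandX μ θ * Real.sin (bandX μ θ) + bandY μ θ * Real.sin (bandY μ θ)) := by
  have hW : 0 < bandX μ θ * Real.sin (bandX μ θ) + bandY μ θ * Real.sin (bandY μ θ) := by
    rw [klfs_W_eq hμ₁ hμ₂]
    exact mul_pos (bandNormalCoeff_pos hμ₁ hμ₂ θ) (pow_pos (bandFermiRadius_pos hμ₁ hμ₂ θ) 2)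
  rw [eq_div_iff hW.ne', mul_comm]
  exact klfs_W_mul_bandAX hμ₁ hμ₂ θ

/-- The solved acceleration `Y'' = (2uu' sin X - Y H)/W` on the hole-doped band. [folklore] -/
theorem kltl_bandAY_eq_div {μ : ℝ} (hμ₁ : -4 < μ) (hμ₂ : μ < 0) (θ : ℝ) :
    bandAY μ θ = (2 * bandFermiRadius μ θ * bandFermiRadiusDeriv μ θ * Real.sin (bandX μ θ) -
        bandY μ θ * (Real.cos (bandX μ θ) * bandVX μ θ ^ 2 + Real.cos (bandY μ θ) * bandVY μ θ ^ 2)) /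
      (bandX μ θ * Real.sin (bandX μ θ) + bandY μ θ * Real.sin (bandY μ θ)) := by
  have hW : 0 < bandX μ θ * Real.sin (bandX μ θ) + bandY μ θ * Real.sin (bandY μ θ) := by
    rw [klfs_W_eq hμ₁ hμ₂]
    exact mul_pos (bandNormalCoeff_pos hμ₁ hμ₂ θ) (pow_pos (bandFermiRadius_pos hμ₁ hμ₂ θ) 2)
  rw [eq_div_iff hW.ne', mul_comm]
  exact klfs_W_mul_bandAY hμ₁ hμ₂ θ

/-- `W = X sin X + Y sin Y` jointly continuous. [folklore] -/
theorem kltl_continuousOn_W :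
    ContinuousOn (fun p : ℝ × ℝ × ℝ × ℝ => bandX p.1 p.2.2.2 * Real.sin (bandX p.1 p.2.2.2) +
      bandY p.1 p.2.2.2 * Real.sin (bandY p.1 p.2.2.2)) {p | p.1 ∈ Ioo (-4 : ℝ) 0} :=
  (kltl_continuousOn_bandX.mul (Real.continuous_sin.comp_continuousOn kltl_continuousOn_bandX)).add
    (kltl_continuousOn_bandY.mul (Real.continuous_sin.comp_continuousOn kltl_continuousOn_bandY))

/-- `H = cos X·X'² + cos Y·Y'²` jointly continuous. [folklore] -/
theorem kltl_continuousOn_H :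
    ContinuousOn (fun p : ℝ × ℝ × ℝ × ℝ => Real.cos (bandX p.1 p.2.2.2) * bandVX p.1 p.2.2.2 ^ 2 +
      Real.cos (bandY p.1 p.2.2.2) * bandVY p.1 p.2.2.2 ^ 2) {p | p.1 ∈ Ioo (-4 : ℝ) 0} :=
  ((Real.continuous_cos.comp_continuousOn kltl_continuousOn_bandX).mul (kltl_continuousOn_bandVX.pow 2)).add
    ((Real.continuous_cos.comp_continuousOn kltl_continuousOn_bandY).mul (kltl_continuousOn_bandVY.pow 2))

/-- `X''` jointly continuous. [folklore] -/
theorem kltl_continuousOn_bandAX :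
    ContinuousOn (fun p : ℝ × ℝ × ℝ × ℝ => bandAX p.1 p.2.2.2) {p | p.1 ∈ Ioo (-4 : ℝ) 0} := by
  have hW0 : ∀ p ∈ {p : ℝ × ℝ × ℝ × ℝ | p.1 ∈ Ioo (-4 : ℝ) 0},
      bandX p.1 p.2.2.2 * Real.sin (bandX p.1 p.2.2.2) + bandY p.1 p.2.2.2 * Real.sin (bandY p.1 p.2.2.2) ≠ 0 := by
    intro p hp
    rw [klfs_W_eq hp.1 hp.2]
    exact (mul_pos (bandNormalCoeff_pos hp.1 hp.2 _) (pow_pos (bandFermiRadius_pos hp.1 hp.2 _) 2)).ne'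
  have h := (((kltl_continuousOn_bandX.mul kltl_continuousOn_H).add
    (((continuousOn_const.mul kltl_continuousOn_radius).mul kltl_continuousOn_radiusDeriv).mul
      (Real.continuous_sin.comp_continuousOn kltl_continuousOn_bandY))).neg.div kltl_continuousOn_W hW0 :
    ContinuousOn (fun p : ℝ × ℝ × ℝ × ℝ => -(bandX p.1 p.2.2.2 *
        (Real.cos (bandX p.1 p.2.2.2) * bandVX p.1 p.2.2.2 ^ 2 + Real.cos (bandY p.1 p.2.2.2) * bandVY p.1 p.2.2.2 ^ 2) +
        2 * bandFermiRadius p.1 p.2.2.2 * bandFermiRadiusDeriv p.1 p.2.2.2 * Real.sin (bandY p.1 p.2.2.2)) /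
      (bandX p.1 p.2.2.2 * Real.sin (bandX p.1 p.2.2.2) + bandY p.1 p.2.2.2 * Real.sin (bandY p.1 p.2.2.2))) _)
  exact h.congr fun p hp => kltl_bandAX_eq_div hp.1 hp.2 _

/-- `Y''` jointly continuous. [folklore] -/
theorem kltl_continuousOn_bandAY :
    ContinuousOn (fun p : ℝ × ℝ × ℝ × ℝ => bandAY p.1 p.2.2.2) {p | p.1 ∈ Ioo (-4 : ℝ) 0} := by
  have hW0 : ∀ p ∈ {p : ℝ × ℝ × ℝ × ℝ | p.1 ∈ Ioo (-4 : ℝ) 0},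
      bandX p.1 p.2.2.2 * Real.sin (bandX p.1 p.2.2.2) + bandY p.1 p.2.2.2 * Real.sin (bandY p.1 p.2.2.2) ≠ 0 := by
    intro p hp
    rw [klfs_W_eq hp.1 hp.2]
    exact (mul_pos (bandNormalCoeff_pos hp.1 hp.2 _) (pow_pos (bandFermiRadius_pos hp.1 hp.2 _) 2)).ne'
  have h := (((((continuousOn_const.mul kltl_continuousOn_radius).mul kltl_continuousOn_radiusDeriv).mul
      (Real.continuous_sin.comp_continuousOn kltl_continuousOn_bandX)).sub
    (kltl_continuousOn_bandY.mul kltl_continuousOn_H)).div kltl_continuousOn_W hW0 :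
    ContinuousOn (fun p : ℝ × ℝ × ℝ × ℝ =>
      (2 * bandFermiRadius p.1 p.2.2.2 * bandFermiRadiusDeriv p.1 p.2.2.2 * Real.sin (bandX p.1 p.2.2.2) -
        bandY p.1 p.2.2.2 *
          (Real.cos (bandX p.1 p.2.2.2) * bandVX p.1 p.2.2.2 ^ 2 + Real.cos (bandY p.1 p.2.2.2) * bandVY p.1 p.2.2.2 ^ 2)) /
      (bandX p.1 p.2.2.2 * Real.sin (bandX p.1 p.2.2.2) + bandY p.1 p.2.2.2 * Real.sin (bandY p.1 p.2.2.2))) _)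
  exact h.congr fun p hp => kltl_bandAY_eq_div hp.1 hp.2 _

/-- `G_c(θ)` jointly continuous in `(μ, c₁, c₂, θ)`. [folklore] -/
theorem kltl_continuousOn_level :
    ContinuousOn (fun p : ℝ × ℝ × ℝ × ℝ => klTwoLoopLevel p.1 p.2.1 p.2.2.1 p.2.2.2) {p | p.1 ∈ Ioo (-4 : ℝ) 0} := by
  have hc₁ : Continuous fun p : ℝ × ℝ × ℝ × ℝ => p.2.1 := by fun_prop
  have hc₂ : Continuous fun p : ℝ × ℝ × ℝ × ℝ => p.2.2.1 := by fun_prop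
  have hμ : Continuous fun p : ℝ × ℝ × ℝ × ℝ => p.1 := by fun_prop
  have hx := ((kltl_continuousOn_bandX.sub hc₁.continuousOn).div_const 2)
  have hy := ((kltl_continuousOn_bandY.sub hc₂.continuousOn).div_const 2)
  have h := ((continuousOn_const (c := (-2 : ℝ))).mul ((Real.continuous_cos.comp_continuousOn hx).add
    (Real.continuous_cos.comp_continuousOn hy))).sub hμ.continuousOn
  exact h.congr fun p _ => by simp only [klTwoLoopLevel]; rfl

/-- `G_c'(θ)` jointly continuous in `(μ, c₁, c₂, θ)`. [folklore] -/
theorem kltl_continuousOn_levelDeriv :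
    ContinuousOn (fun p : ℝ × ℝ × ℝ × ℝ => klTwoLoopLevelDeriv p.1 p.2.1 p.2.2.1 p.2.2.2) {p | p.1 ∈ Ioo (-4 : ℝ) 0} := by
  have hc₁ : Continuous fun p : ℝ × ℝ × ℝ × ℝ => p.2.1 := by fun_prop
  have hc₂ : Continuous fun p : ℝ × ℝ × ℝ × ℝ => p.2.2.1 := by fun_prop
  have hx := ((kltl_continuousOn_bandX.sub hc₁.continuousOn).div_const 2)
  have hy := ((kltl_continuousOn_bandY.sub hc₂.continuousOn).div_const 2)
  have h := ((Real.continuous_sin.comp_continuousOn hx).mul kltl_continuousOn_bandVX).add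
    ((Real.continuous_sin.comp_continuousOn hy).mul kltl_continuousOn_bandVY)
  exact h.congr fun p _ => by simp only [klTwoLoopLevelDeriv]; rfl

/-- `G_c''(θ)` jointly continuous in `(μ, c₁, c₂, θ)`. [folklore] -/
theorem kltl_continuousOn_levelDeriv₂ :
    ContinuousOn (fun p : ℝ × ℝ × ℝ × ℝ => klTwoLoopLevelDeriv₂ p.1 p.2.1 p.2.2.1 p.2.2.2) {p | p.1 ∈ Ioo (-4 : ℝ) 0} := by
  have hc₁ : Continuous fun p : ℝ × ℝ × ℝ × ℝ => p.2.1 := by fun_prop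
  have hc₂ : Continuous fun p : ℝ × ℝ × ℝ × ℝ => p.2.2.1 := by fun_prop
  have hx := ((kltl_continuousOn_bandX.sub hc₁.continuousOn).div_const 2)
  have hy := ((kltl_continuousOn_bandY.sub hc₂.continuousOn).div_const 2)
  have h := ((((Real.continuous_cos.comp_continuousOn hx).mul (kltl_continuousOn_bandVX.pow 2)).div_const 2).add
      ((Real.continuous_sin.comp_continuousOn hx).mul kltl_continuousOn_bandAX)).add
    ((((Real.continuous_cos.comp_continuousOn hy).mul (kltl_continuousOn_bandVY.pow 2)).div_const 2).add
      ((Real.continuous_sin.comp_continuousOn hy).mul kltl_continuousOn_bandAY))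
  exact h.congr fun p _ => by simp only [klTwoLoopLevelDeriv₂]; rfl

end Joint

end Summit.HubbardSuperconductivity.HubbardSuperconductivity.Theorems

end
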